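import Literature.Computability.Complexity.FoldBricks
import Literature.Computability.Complexity.PairPlumbing
import Literature.Computability.Complexity.TM2PassThrough
import HarnessLib

/-!
# Unary-expression bricks: a compiler from arithmetic size expressions to `FP` string functions

Trunk toolkit in the algebra-of-`FP`-functions style of `BrickAlgebra.lean` / `FoldBricks.lean`.
A machine assembled from bricks spends much of its text computing *sizes* — block lengths, loop
counts, paddings — as unary words `1ᵛ` from unary arguments, by the same handful of bricks
(`onesFn`, concatenation, `umulFn`, `dropFn`, `lenBinF`, `binToUnaryFn`), each use with its own
`_apply` and `_mem_FP` lemma. This file proves the pattern once, as a tiny deep embedding: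

* `UExpr` — expressions in variables `var i` (read through argument maps `arg i`, normalised to
  their length) built from constants, `+`, `·`, truncated `−`, the binary length
  `blen e = |encodeNat e|` and `pow2 e = 2^{|encodeNat e|}` (the least power of two exceeding `e`,
  `lt_pow2`, `pow2_le`);
* `UExpr.eval ρ e : ℕ` — the value in the environment `ρ : ℕ → ℕ`;
* `UExpr.compile arg e : List Bool → List Bool` with **`compile_apply`**:
  `compile arg e w = 1^{eval (fun i => |arg i w|) e}` on EVERY input `w`, and **`compile_mem_FP`**
  (for argument maps in `FP`); the instances `compile₁` (one unary argument, the whole input) and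
  `compile₂` (two arguments `⟨u, v⟩`, read by `fstF`/`sndF`).

`pow2` is compiled without a loop: `2^{|bin v|} - 1 = ⟦1^{|bin v|}⟧` (`Brick.bitsToNat_ones`) is
converted back to unary by `binToUnaryFn` against the ruler `1ᵛ1ᵛ1` (long enough because
`2^{|bin v|} ≤ 2v + 1`), and a final `1` is prepended.

## References

* S. Arora, B. Barak, *Computational Complexity: A Modern Approach*, CUP 2009, §1.3 (polynomial
  time is closed under composition; unary counters).
-/

namespace Literature.Computability.Complexity

open _root_.Computability Brick Plumb

/-- Size expressions: variables, constants, sum, product, truncated difference, binary length and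
the power of two `2^{binary length}`. [folklore] -/
inductive UExpr : Type
  | var (i : ℕ) : UExpr
  | cst (c : ℕ) : UExpr
  | add (e₁ e₂ : UExpr) : UExpr
  | mul (e₁ e₂ : UExpr) : UExpr
  | sub (e₁ e₂ : UExpr) : UExpr
  | blen (e : UExpr) : UExpr
  | pow2 (e : UExpr) : UExpr

namespace UExpr

/-- The value of a size expression in the environment `ρ`. [folklore] -/
def eval (ρ : ℕ → ℕ) : UExpr → ℕ
  | var i => ρ i
  | cst c => c
  | add e₁ e₂ => eval ρ e₁ + eval ρ e₂
  | mul e₁ e₂ => eval ρ e₁ * eval ρ e₂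
  | sub e₁ e₂ => eval ρ e₁ - eval ρ e₂
  | blen e => (encodeNat (eval ρ e)).length
  | pow2 e => 2 ^ (encodeNat (eval ρ e)).length

/-- Value of a variable. [folklore] -/
@[simp] theorem eval_var (ρ : ℕ → ℕ) (i : ℕ) : eval ρ (var i) = ρ i := rfl
/-- Value of a constant. [folklore] -/
@[simp] theorem eval_cst (ρ : ℕ → ℕ) (c : ℕ) : eval ρ (cst c) = c := rfl
/-- Value of a sum. [folklore] -/
@[simp] theorem eval_add (ρ : ℕ → ℕ) (e₁ e₂ : UExpr) : eval ρ (add e₁ e₂) = eval ρ e₁ + eval ρ e₂ := rfl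
/-- Value of a product. [folklore] -/
@[simp] theorem eval_mul (ρ : ℕ → ℕ) (e₁ e₂ : UExpr) : eval ρ (mul e₁ e₂) = eval ρ e₁ * eval ρ e₂ := rfl
/-- Value of a truncated difference. [folklore] -/
@[simp] theorem eval_sub (ρ : ℕ → ℕ) (e₁ e₂ : UExpr) : eval ρ (sub e₁ e₂) = eval ρ e₁ - eval ρ e₂ := rfl
/-- Value of a binary length. [folklore] -/
@[simp] theorem eval_blen (ρ : ℕ → ℕ) (e : UExpr) : eval ρ (blen e) = (encodeNat (eval ρ e)).length := rfl
/-- Value of a power of two. [folklore] -/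
@[simp] theorem eval_pow2 (ρ : ℕ → ℕ) (e : UExpr) : eval ρ (pow2 e) = 2 ^ (encodeNat (eval ρ e)).length := rfl

/-- The value depends only on the environment at the variables (extensionality in `ρ`). [folklore] -/
theorem eval_congr {ρ ρ' : ℕ → ℕ} (h : ∀ i, ρ i = ρ' i) : ∀ e, eval ρ e = eval ρ' e
  | var i => h i
  | cst _ => rfl
  | add e₁ e₂ => by rw [eval_add, eval_add, eval_congr h e₁, eval_congr h e₂]
  | mul e₁ e₂ => by rw [eval_mul, eval_mul, eval_congr h e₁, eval_congr h e₂]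
  | sub e₁ e₂ => by rw [eval_sub, eval_sub, eval_congr h e₁, eval_congr h e₂]
  | blen e => by rw [eval_blen, eval_blen, eval_congr h e]
  | pow2 e => by rw [eval_pow2, eval_pow2, eval_congr h e]

/-! ### The two bounds on binary length -/

/-- `e < pow2 e = 2^{|bin e|}` (the value of `e` has `|bin e|` binary digits). [folklore] -/
theorem lt_pow2 (ρ : ℕ → ℕ) (e : UExpr) : eval ρ e < eval ρ (pow2 e) := by
  simpa using bitsToNat_lt (encodeNat (eval ρ e))

/-- `pow2 e ≤ 2e + 1` (`|bin v| ≤ log₂ v + 1`). [folklore] -/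
theorem pow2_le (ρ : ℕ → ℕ) (e : UExpr) : eval ρ (pow2 e) ≤ 2 * eval ρ e + 1 := by
  rw [eval_pow2]
  rcases Nat.eq_zero_or_pos (eval ρ e) with h0 | hv
  · rw [h0]; simp [encodeNat, encodeNum]
  · calc 2 ^ (encodeNat (eval ρ e)).length
        ≤ 2 ^ (Nat.log 2 (eval ρ e) + 1) := Nat.pow_le_pow_right (by norm_num) (TM2Pass.length_encodeNat_le _)
      _ = 2 * 2 ^ Nat.log 2 (eval ρ e) := by rw [pow_succ, mul_comm]
      _ ≤ 2 * eval ρ e := Nat.mul_le_mul_left 2 (Nat.pow_log_le_self 2 hv.ne')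
      _ ≤ 2 * eval ρ e + 1 := Nat.le_succ _

/-- `blen e ≤ e`. [folklore] -/
theorem blen_le (ρ : ℕ → ℕ) (e : UExpr) : eval ρ (blen e) ≤ eval ρ e := by
  rw [eval_blen]
  by_contra hc
  push Not at hc
  have h2 := pow2_le ρ e
  rw [eval_pow2] at h2
  have h3 : 2 ^ (eval ρ e + 1) ≤ 2 ^ (encodeNat (eval ρ e)).length := Nat.pow_le_pow_right (by norm_num) hc
  have h4 : 2 * eval ρ e + 1 < 2 ^ (eval ρ e + 1) := by
    have := @Nat.lt_two_pow_self (eval ρ e)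
    rw [pow_succ]; omega
  omega

/-! ### Compilation -/

/-- The compiled string function (argument `i` read through `arg i`, as the length of its value).
[folklore] -/
noncomputable def compile (arg : ℕ → (List Bool → List Bool)) : UExpr → (List Bool → List Bool)
  | var i => onesFn ∘ arg i
  | cst c => fun _ => ones c
  | add e₁ e₂ => fun w => compile arg e₁ w ++ compile arg e₂ w
  | mul e₁ e₂ => HashBricks.umulFn ∘ fanoutFn (compile arg e₁) (compile arg e₂)
  | sub e₁ e₂ => dropFn ∘ fanoutFn (compile arg e₂) (compile arg e₁)
  | blen e => onesFn ∘ lenBinF ∘ compile arg e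
  | pow2 e => List.cons true ∘ binToUnaryFn ∘
      fanoutFn (fun w => compile arg e w ++ compile arg e w ++ [true]) (onesFn ∘ lenBinF ∘ compile arg e)

/-- **Value of the compiled function**: `1^{eval}` in the environment of argument lengths, on every
input. [folklore] -/
theorem compile_apply (arg : ℕ → (List Bool → List Bool)) :
    ∀ (e : UExpr) (w : List Bool), compile arg e w = ones (eval (fun i => (arg i w).length) e)
  | var i, w => by simp [compile, onesFn, unaryEncodeNat_eq_replicate, ones]
  | cst c, w => rfl
  | add e₁ e₂, w => by
    change compile arg e₁ w ++ compile arg e₂ w = _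
    rw [compile_apply arg e₁ w, compile_apply arg e₂ w, eval_add]
    simp [ones]
  | mul e₁ e₂, w => by
    rw [compile, Function.comp_apply, fanoutFn_apply, compile_apply arg e₁ w, compile_apply arg e₂ w,
      HashBricks.umulFn_boolPair, eval_mul]
  | sub e₁ e₂, w => by
    rw [compile, Function.comp_apply, fanoutFn_apply, compile_apply arg e₁ w, compile_apply arg e₂ w,
      dropFn_boolPair, eval_sub]
    simp [ones]
  | blen e, w => by
    rw [compile, Function.comp_apply, Function.comp_apply, compile_apply arg e w, lenBinF_apply, eval_blen]
    simp [ones, onesFn, unaryEncodeNat_eq_replicate]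
  | pow2 e, w => by
    rw [compile, Function.comp_apply, Function.comp_apply, fanoutFn_apply, Function.comp_apply, Function.comp_apply,
      compile_apply arg e w, lenBinF_apply, binToUnaryFn_boolPair, eval_pow2]
    generalize eval (fun i => (arg i w).length) e = v
    simp only [List.length_replicate, List.length_append, List.length_singleton, onesFn, unaryEncodeNat_eq_replicate]
    rw [show List.replicate (encodeNat v).length true = ones (encodeNat v).length from rfl, bitsToNat_ones]
    rw [min_eq_left (by have := pow2_le (fun _ => v) (var 0); simp only [eval_pow2, eval_var] at this; omega)]
    have h1 : 1 ≤ 2 ^ (encodeNat v).length := Nat.one_le_two_pow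
    rw [show (2 ^ (encodeNat v).length) = (2 ^ (encodeNat v).length - 1) + 1 by omega]
    rfl

/-- **The compiled function is in `FP`** when the argument maps are. [cite: AroraBarakCC2009, §1.3] -/
theorem compile_mem_FP {arg : ℕ → (List Bool → List Bool)} (harg : ∀ i, arg i ∈ FP) :
    ∀ e : UExpr, compile arg e ∈ FP
  | var i => comp_mem_FP onesFn_mem_FP (harg i)
  | cst _ => const_mem_FP _
  | add e₁ e₂ => append_mem_FP (compile_mem_FP harg e₁) (compile_mem_FP harg e₂)
  | mul e₁ e₂ => comp_mem_FP HashBricks.umulFn_mem_FP (fanoutFn_mem_FP (compile_mem_FP harg e₁) (compile_mem_FP harg e₂))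
  | sub e₁ e₂ => comp_mem_FP dropFn_mem_FP (fanoutFn_mem_FP (compile_mem_FP harg e₂) (compile_mem_FP harg e₁))
  | blen e => comp_mem_FP onesFn_mem_FP (comp_mem_FP lenBinF_mem_FP (compile_mem_FP harg e))
  | pow2 e => comp_mem_FP (cons_mem_FP true) (comp_mem_FP binToUnaryFn_mem_FP (fanoutFn_mem_FP
      (append_mem_FP (append_mem_FP (compile_mem_FP harg e) (compile_mem_FP harg e)) (const_mem_FP _))
      (comp_mem_FP onesFn_mem_FP (comp_mem_FP lenBinF_mem_FP (compile_mem_FP harg e)))))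

/-- The length of the compiled value is the value. [folklore] -/
theorem length_compile (arg : ℕ → (List Bool → List Bool)) (e : UExpr) (w : List Bool) :
    (compile arg e w).length = eval (fun i => (arg i w).length) e := by
  rw [compile_apply]; simp [ones]

/-! ### One and two unary arguments -/

/-- One argument: the whole input, `var i ↦ 1^{|w|}` for every `i`. [folklore] -/
noncomputable def compile₁ (e : UExpr) : List Bool → List Bool := compile (fun _ => id) e

/-- `compile₁ e (1ⁿ) = 1^{e(n)}`, indeed `compile₁ e w = 1^{e(|w|)}` on every `w`. [folklore] -/
@[simp] theorem compile₁_apply (e : UExpr) (w : List Bool) : compile₁ e w = ones (eval (fun _ => w.length) e) := by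
  rw [compile₁, compile_apply]; rfl

/-- `compile₁ e ∈ FP`. [cite: AroraBarakCC2009, §1.3] -/
theorem compile₁_mem_FP (e : UExpr) : compile₁ e ∈ FP := compile_mem_FP (fun _ => Brick_id_mem_FP) e
  where
  /-- `id ∈ FP` (local restatement to keep imports light). [folklore] -/
  Brick_id_mem_FP : (id : List Bool → List Bool) ∈ FP := PolyTimeComputable.id _

/-- Two arguments `⟨u, v⟩`: `var 0 ↦ 1^{|u|}`, every other variable `↦ 1^{|v|}`. [folklore] -/
noncomputable def compile₂ (e : UExpr) : List Bool → List Bool := compile (fun i => if i = 0 then fstF else sndF) e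

/-- `compile₂ e ⟨u, v⟩ = 1^{e(|u|, |v|)}`. [folklore] -/
@[simp] theorem compile₂_boolPair (e : UExpr) (u v : List Bool) :
    compile₂ e (boolPair u v) = ones (eval (fun i => if i = 0 then u.length else v.length) e) := by
  rw [compile₂, compile_apply]
  congr 1
  apply eval_congr
  intro i
  by_cases hi : i = 0 <;> simp [hi]

/-- `compile₂ e ∈ FP`. [cite: AroraBarakCC2009, §1.3] -/
theorem compile₂_mem_FP (e : UExpr) : compile₂ e ∈ FP :=
  compile_mem_FP (fun i => by by_cases hi : i = 0 <;> simp [hi, fstF_mem_FP, sndF_mem_FP]) e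

end UExpr

end Literature.Computability.Complexity
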